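import Mathlib
import HarnessLib
import Literature.NumberTheory.Transcendental.AssociatorsBarEval

/-!
# `KernelModuloPeriodConjecture`, line `Sketch`: Euler's recursion for pentagon solutions

Crux `FurushoPentagon.KernelModuloPeriodConjecture` (stmt-KontsevichZagierPeriods-15058), line
`Sketch`, registered stub `stub_eulerRecursion` (skeleton v8, lead c3): for every group-like
solution `φ` of Drinfeld's pentagon equation over a commutative `ℚ`-algebra and every `n ≥ 2`,

  `(2n+1) c_{(2n)}(φ) = -2 Σ_{j=1}^{n-1} c_{(2j)}(φ) c_{(2n-2j)}(φ)`,

where `c_{(m)}(φ) = c_{x₀^{m-1}x₁}(φ)`; at `Φ_KZ` (`c_{(m)} = -ζ(m)`) this is Euler's recursion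
`(2n+1) ζ(2n) = 2 Σ ζ(2j) ζ(2n-2j)`, whence `ζ(2n) ∈ ℚ ζ(2)ⁿ`.

## Proof (Gangl–Kaneko–Zagier's parity argument in the formal double zeta space, [GanglKanekoZagier2006, §2])

In weight `k = 2n` write `Z = c_{(k)}`, `D(a) = c_{(a, k-a)}` (`1 ≤ a ≤ k-1`; `D(1)` is the
coefficient of the non-convergent word `x₁x₀^{k-2}x₁`) and `P(r) = c_{(r)} c_{(k-r)}`. Two
families of relations hold at every group-like pentagon solution:

* **shuffle** (group-likeness; the depth-one shuffle product with binomial multiplicities is the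
  hypothesis of the stub, proved separately as `stub_shuffleDepthOne`): for `1 ≤ r ≤ k-1`,
  `P(r) = Σ_{i<r} C(k-r-1+i, i) D(k-r+i) + Σ_{j<k-r} C(r-1+j, j) D(r+j)` — for `r = 1` with
  `P(1) = 0` because `c_{x₁}(φ) = 0` (`DrinfeldPentagon.apply_letter_eq_zero_of_isGroupLike`);
* **stuffle** (Furusho's theorem in coefficient form, `DrinfeldPentagon.piY_mul_piY_eq_sum_stuffle`,
  for `(r) ∗ (k-r)`, and for `r = 1` the regularised instance `(k-1) ∗ (1)` with `π_Y(φ)(1) = 0`):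
  `P(r) = D(r) + D(k-r) - Z` for `1 ≤ r ≤ k-1`.

Then (i) `r = 1`: `Σ_{a=2}^{k-1} D(a) = -Z` (the sum formula); (ii) the alternating sum
`Σ_r (-1)^{r+1}(shuffle_r - stuffle_r)`, using `Σ_r (-1)^{r+1} C(a-1, r-1) = [a = 1]`, gives
`Σ_{a odd ≥ 3} D(a) - Σ_{a even} D(a) = Z/2`; hence `Σ_{a even} D(a) = -3Z/4`, and summing the stuffle
relations over even `r` gives `Σ_{r even} P(r) = 2 Σ_{a even} D(a) - (n-1) Z = -(2n+1) Z / 2`.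

References: H. Gangl, M. Kaneko, D. Zagier, *Double zeta values and modular forms*, in: Automorphic
forms and zeta functions, World Sci. (2006), 71–106, §2 Thm 1 [GanglKanekoZagier2006]; K. Ihara, M. Kaneko,
D. Zagier, Compos. Math. 142 (2006) §2 [IharaKanekoZagier2006]; H. Furusho, Ann. of Math. 174
(2011) Thm 1.2, §5 [Furusho2011].
-/

namespace Summit.KontsevichZagierPeriods.FurushoPentagon.KernelModuloPeriodConjecture

open Literature.NumberTheory.Transcendental
open Finset

section Combinatorics

variable {R : Type} [CommRing R]

/-- Reflection `r ↦ k - r` on `[1, k)`: `Σ_{r=1}^{k-1} g(k-r) = Σ_{r=1}^{k-1} g(r)`. [folklore] -/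
theorem euler_sum_Ico_one_reflect (g : ℕ → R) (k : ℕ) :
    ∑ r ∈ Ico 1 k, g (k - r) = ∑ r ∈ Ico 1 k, g r := by
  refine Finset.sum_nbij' (fun r => k - r) (fun r => k - r) ?_ ?_ ?_ ?_ ?_
  · intro r hr; simp only [mem_Ico] at hr ⊢; omega
  · intro r hr; simp only [mem_Ico] at hr ⊢; omega
  · intro r hr; simp only [mem_Ico] at hr; omega
  · intro r hr; simp only [mem_Ico] at hr; omega
  · intro r _; rfl

/-- Even/odd splitting of `[2, 2n)`: `Σ_{a=2}^{2n-1} g(a) = Σ_{j=1}^{n-1} (g(2j) + g(2j+1))`.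
[folklore] -/
theorem euler_sum_Ico_two_even_odd (g : ℕ → R) : ∀ n : ℕ, 1 ≤ n →
    ∑ a ∈ Ico 2 (2 * n), g a = ∑ j ∈ Ico 1 n, (g (2 * j) + g (2 * j + 1)) := by
  refine Nat.le_induction (by simp) fun n hn ih => ?_
  rw [show 2 * (n + 1) = 2 * n + 1 + 1 by ring, Finset.sum_Ico_succ_top (by omega),
    Finset.sum_Ico_succ_top (by omega), ih, Finset.sum_Ico_succ_top hn]
  ring

/-- Alternating even/odd splitting of `[1, 2n)`:
`Σ_{r=1}^{2n-1} (-1)^{r+1} g(r) = g(1) + Σ_{j=1}^{n-1} (g(2j+1) - g(2j))`. [folklore] -/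
theorem euler_altSum_Ico_one (g : ℕ → R) : ∀ n : ℕ, 1 ≤ n →
    ∑ r ∈ Ico 1 (2 * n), (-1 : R) ^ (r + 1) * g r =
      g 1 + ∑ j ∈ Ico 1 n, (g (2 * j + 1) - g (2 * j)) := by
  refine Nat.le_induction (by simp [show (Ico 1 2 : Finset ℕ) = {1} from rfl]) fun n hn ih => ?_
  rw [show 2 * (n + 1) = 2 * n + 1 + 1 by ring, Finset.sum_Ico_succ_top (by omega),
    Finset.sum_Ico_succ_top (by omega), ih, Finset.sum_Ico_succ_top hn]
  have h1 : (-1 : R) ^ (2 * n + 1) = -1 := by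
    rw [pow_succ, pow_mul]; simp
  have h2 : (-1 : R) ^ (2 * n + 1 + 1) = 1 := by
    rw [pow_succ, h1]; simp
  rw [h1, h2]
  ring

/-- The alternating binomial sum behind GKZ's parity argument: for `k ≥ 2` and any `f`,
`Σ_{r=1}^{k-1} (-1)^{r+1} Σ_{j<k-r} C(r-1+j, j) f(r+j) = f(1)` (each `f(a)` is counted
`Σ_{r=1}^{a} (-1)^{r+1} C(a-1, r-1) = [a = 1]` times). [cite: GanglKanekoZagier2006, §2 Thm 1] -/
theorem euler_altBinomSum (f : ℕ → R) : ∀ k : ℕ, 2 ≤ k →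
    ∑ r ∈ Ico 1 k, (-1 : R) ^ (r + 1) *
        ∑ j ∈ range (k - r), ((r - 1 + j).choose j : R) * f (r + j) = f 1 := by
  refine Nat.le_induction (by simp [show (Ico 1 2 : Finset ℕ) = {1} from rfl]) fun k hk ih => ?_
  -- the new contributions all carry `f k`, with total coefficient an alternating binomial sum
  have hsplit : ∀ r ∈ Ico 1 k, (-1 : R) ^ (r + 1) *
      ∑ j ∈ range (k + 1 - r), ((r - 1 + j).choose j : R) * f (r + j) =
      (-1 : R) ^ (r + 1) * ∑ j ∈ range (k - r), ((r - 1 + j).choose j : R) * f (r + j) +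
        (-1 : R) ^ (r + 1) * ((k - 1).choose (k - r) : R) * f k := by
    intro r hr
    rw [mem_Ico] at hr
    rw [show k + 1 - r = (k - r) + 1 by omega, Finset.sum_range_succ,
      show r - 1 + (k - r) = k - 1 by omega, show r + (k - r) = k by omega]
    ring
  rw [Finset.sum_Ico_succ_top (by omega), Finset.sum_congr rfl hsplit, Finset.sum_add_distrib, ih,
    show k + 1 - k = 0 + 1 by omega, Finset.sum_range_succ, Finset.sum_range_zero]
  -- the alternating binomial sum `Σ_{r=1}^{k} (-1)^{r+1} C(k-1, k-r) = 0` (`k - 1 ≠ 0`)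
  have halt : ∑ r ∈ Ico 1 k, (-1 : R) ^ (r + 1) * ((k - 1).choose (k - r) : R) +
      (-1 : R) ^ (k + 1) * ((k - 1).choose (k - k) : R) = 0 := by
    rw [← Finset.sum_Ico_succ_top (b := k) (by omega)
      (f := fun r => (-1 : R) ^ (r + 1) * ((k - 1).choose (k - r) : R)),
      Finset.sum_Ico_eq_sum_range, show k + 1 - 1 = (k - 1) + 1 by omega]
    have hz := Int.alternating_sum_range_choose_of_ne (n := k - 1) (by omega)
    have hz' := congrArg (Int.cast : ℤ → R) hz
    push_cast at hz'
    rw [← hz']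
    refine Finset.sum_congr rfl fun i hi => ?_
    rw [mem_range] at hi
    rw [show k - (1 + i) = (k - 1) - i by omega, Nat.choose_symm (by omega),
      show 1 + i + 1 = i + 2 by ring]
    ring
  simp only [Nat.sub_self, Nat.choose_zero_right, Nat.cast_one, mul_one] at halt ⊢
  rw [← Finset.sum_mul]
  linear_combination (f k) * halt

end Combinatorics

section Main

variable {R : Type} [CommRing R] [Algebra ℚ R] {φ : NCSeries Bool R}

/-- **The stuffle relation `(r) ∗ (s)` at a pentagon solution** (`r, s ≥ 2`), in raw coefficients:
`c_{(r)} c_{(s)} = c_{(r,s)} + c_{(s,r)} - c_{(r+s)}` (Furusho's `π_Y(φ)(r) π_Y(φ)(s) = Σ_{(r)∗(s)} π_Y(φ)`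
with `π_Y(φ)(m) = -c_{(m)}`, `π_Y(φ)(a,b) = c_{(a,b)}`). [cite: Furusho2011, §5] -/
theorem euler_stuffle_depthOne (hg : NCSeries.IsGroupLike φ) (h5 : NCSeries.DrinfeldPentagon φ)
    {r s : ℕ} (hr : 2 ≤ r) (hs : 2 ≤ s) :
    φ (MZV.binaryWord [r]) * φ (MZV.binaryWord [s]) =
      φ (MZV.binaryWord [r, s]) + φ (MZV.binaryWord [s, r]) - φ (MZV.binaryWord [r + s]) := by
  have hadm : MZV.IsAdmissible [r] := ⟨fun i hi => by simp at hi; omega, fun _ => by simpa using hr⟩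
  have h := h5.piY_mul_piY_eq_sum_stuffle hg hadm (List.cons_ne_nil _ _) (t := [s])
    (fun i hi => by simp at hi; omega) (List.cons_ne_nil _ _)
  rw [MZV.stuffle_cons_cons, MZV.stuffle_nil_left, MZV.stuffle_nil_right, MZV.stuffle_nil_left] at h
  simp only [List.map_cons, List.map_append, List.map_nil, List.sum_cons, List.sum_append,
    List.sum_nil, add_zero] at h
  rw [NCSeries.piY_apply_singleton φ (n := r) (by omega),
    NCSeries.piY_apply_singleton φ (n := s) (by omega),
    NCSeries.piY_apply_singleton φ (n := r + s) (by omega),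
    NCSeries.piY_apply_of_forall_pos φ (s := [r, s]) (fun i hi => by simp at hi; omega),
    NCSeries.piY_apply_of_forall_pos φ (s := [s, r]) (fun i hi => by simp at hi; omega)] at h
  simp only [List.length_cons, List.length_nil, zero_add, Nat.reduceAdd, even_two, Even.neg_pow,
    one_pow, one_mul] at h
  linear_combination h

/-- **The regularised stuffle relation `(k-1) ∗ (1)` at a pentagon solution** (`k ≥ 3`):
`0 = c_{(k-1,1)} + c_{(1,k-1)} - c_{(k)}`, because `π_Y(φ)(1) = -c_{x₁}(φ) = 0`. [cite: Furusho2011, §5] -/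
theorem euler_stuffle_one (hg : NCSeries.IsGroupLike φ) (h5 : NCSeries.DrinfeldPentagon φ)
    {k : ℕ} (hk : 3 ≤ k) :
    φ (MZV.binaryWord [1, k - 1]) + φ (MZV.binaryWord [k - 1, 1]) - φ (MZV.binaryWord [k]) = 0 := by
  have hadm : MZV.IsAdmissible [k - 1] :=
    ⟨fun i hi => by simp at hi; omega, fun _ => by simp; omega⟩
  have h := h5.piY_mul_piY_eq_sum_stuffle hg hadm (List.cons_ne_nil _ _) (t := [1])
    (fun i hi => by simp at hi; omega) (List.cons_ne_nil _ _)
  rw [MZV.stuffle_cons_cons, MZV.stuffle_nil_left, MZV.stuffle_nil_right, MZV.stuffle_nil_left] at h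
  simp only [List.map_cons, List.map_append, List.map_nil, List.sum_cons, List.sum_append,
    List.sum_nil, add_zero] at h
  have hX1 : φ [true] = 0 := h5.apply_letter_eq_zero_of_isGroupLike hg true
  have h1 : NCSeries.piY φ [1] = 0 := by
    rw [NCSeries.piY_apply_singleton φ le_rfl]
    simpa [MZV.binaryWord] using hX1
  rw [h1, mul_zero, show k - 1 + 1 = k by omega,
    NCSeries.piY_apply_singleton φ (n := k) (by omega),
    NCSeries.piY_apply_of_forall_pos φ (s := [k - 1, 1]) (fun i hi => by simp at hi; omega),
    NCSeries.piY_apply_of_forall_pos φ (s := [1, k - 1]) (fun i hi => by simp at hi; omega)] at h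
  simp only [List.length_cons, List.length_nil, zero_add, Nat.reduceAdd, even_two, Even.neg_pow,
    one_pow, one_mul] at h
  linear_combination -h

/-- **Euler's recursion for pentagon solutions** (registered stub `stub_eulerRecursion` of line
`Sketch`, skeleton v8): for a group-like solution `φ` of Drinfeld's pentagon over a commutative
`ℚ`-algebra satisfying the depth-one shuffle products with binomial multiplicities (stub
`stub_shuffleDepthOne`, group-likeness), `(2n+1) c_{(2n)} = -2 Σ_{j=1}^{n-1} c_{(2j)} c_{(2n-2j)}`
for every `n ≥ 2` — Gangl–Kaneko–Zagier's theorem that Euler's relation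
`Σ_{r even} ζ(r)ζ(k-r) = (k+1)/2 · ζ(k)` lies in the formal double zeta space, transported to
associators by Furusho's double shuffle. [cite: GanglKanekoZagier2006, §2 Thm 1] -/
theorem stub_eulerRecursion :
    ∀ (R : Type) [CommRing R] [Algebra ℚ R] (φ : NCSeries Bool R), NCSeries.IsGroupLike φ →
      NCSeries.DrinfeldPentagon φ →
      (∀ a b : ℕ, 1 ≤ a → 1 ≤ b →
        φ (MZV.binaryWord [a]) * φ (MZV.binaryWord [b]) =
          ∑ i ∈ Finset.range a, ((b - 1 + i).choose i : R) * φ (MZV.binaryWord [b + i, a - i]) +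
            ∑ j ∈ Finset.range b, ((a - 1 + j).choose j : R) * φ (MZV.binaryWord [a + j, b - j])) →
      ∀ n : ℕ, 2 ≤ n →
        (2 * n + 1 : R) * φ (MZV.binaryWord [2 * n]) =
          -2 * ∑ j ∈ Finset.Ico 1 n, φ (MZV.binaryWord [2 * j]) * φ (MZV.binaryWord [2 * (n - j)]) := by
  intro R _ _ φ hg h5 hSh n hn
  -- notation in weight `k = 2n`
  set Z : R := φ (MZV.binaryWord [2 * n]) with hZ
  set D : ℕ → R := fun a => φ (MZV.binaryWord [a, 2 * n - a]) with hD
  set E : R := ∑ j ∈ Ico 1 n, D (2 * j) with hE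
  set O : R := ∑ j ∈ Ico 1 n, D (2 * j + 1) with hO
  have hX1 : φ (MZV.binaryWord [1]) = 0 := by
    simpa [MZV.binaryWord] using h5.apply_letter_eq_zero_of_isGroupLike hg true
  -- the stuffle relations `P(r) = D(r) + D(k-r) - Z`, `1 ≤ r ≤ k-1`
  have hSt1 : D 1 + D (2 * n - 1) - Z = 0 := by
    have h := euler_stuffle_one hg h5 (k := 2 * n) (by omega)
    simp only [hD, hZ, show 2 * n - (2 * n - 1) = 1 by omega]
    exact h
  have hSt : ∀ r, 1 ≤ r → r + 1 ≤ 2 * n →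
      φ (MZV.binaryWord [r]) * φ (MZV.binaryWord [2 * n - r]) = D r + D (2 * n - r) - Z := by
    intro r hr1 hr2
    rcases Nat.lt_or_ge r 2 with h1 | h2
    · obtain rfl : r = 1 := by omega
      rw [hX1, zero_mul, hSt1]
    rcases Nat.lt_or_ge (r + 2) (2 * n + 1) with h3 | h4
    · rw [euler_stuffle_depthOne hg h5 h2 (by omega), show r + (2 * n - r) = 2 * n by omega]
      simp only [hD, hZ, show 2 * n - (2 * n - r) = r by omega]
    · obtain rfl : r = 2 * n - 1 := by omega
      rw [show 2 * n - (2 * n - 1) = 1 by omega, hX1, mul_zero]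
      linear_combination -hSt1
  -- the shuffle relations, second half summed with signs: `Σ_r (-1)^{r+1} Σ_j C(r-1+j,j) D(r+j) = D 1`
  have hA1 : ∑ r ∈ Ico 1 (2 * n), (-1 : R) ^ (r + 1) *
      ∑ j ∈ range (2 * n - r), ((r - 1 + j).choose j : R) * φ (MZV.binaryWord [r + j, 2 * n - r - j]) =
      D 1 := by
    rw [← euler_altBinomSum D (2 * n) (by omega)]
    refine Finset.sum_congr rfl fun r _ => ?_
    congr 1
    refine Finset.sum_congr rfl fun j _ => ?_
    simp only [hD, Nat.sub_sub]
  -- first half: reflect `r ↦ k - r`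
  have hA2 : ∑ r ∈ Ico 1 (2 * n), (-1 : R) ^ (r + 1) *
      ∑ i ∈ range r, ((2 * n - r - 1 + i).choose i : R) * φ (MZV.binaryWord [2 * n - r + i, r - i]) =
      D 1 := by
    rw [← hA1, ← euler_sum_Ico_one_reflect (fun r => (-1 : R) ^ (r + 1) *
      ∑ j ∈ range (2 * n - r), ((r - 1 + j).choose j : R) * φ (MZV.binaryWord [r + j, 2 * n - r - j]))
      (2 * n)]
    refine Finset.sum_congr rfl fun r hr => ?_
    rw [mem_Ico] at hr
    simp only [show 2 * n - (2 * n - r) = r by omega]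
    rw [neg_one_pow_eq_pow_mod_two (R := R) (n := r + 1),
      neg_one_pow_eq_pow_mod_two (R := R) (n := 2 * n - r + 1),
      show (r + 1) % 2 = (2 * n - r + 1) % 2 by omega]
  -- `Σ_r (-1)^{r+1} P(r)` via shuffle: `= 2 D(1)`
  have hParSh : ∑ r ∈ Ico 1 (2 * n), (-1 : R) ^ (r + 1) *
      (φ (MZV.binaryWord [r]) * φ (MZV.binaryWord [2 * n - r])) = D 1 + D 1 := by
    have h : ∀ r ∈ Ico 1 (2 * n), (-1 : R) ^ (r + 1) *
        (φ (MZV.binaryWord [r]) * φ (MZV.binaryWord [2 * n - r])) =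
        (-1 : R) ^ (r + 1) * ∑ i ∈ range r, ((2 * n - r - 1 + i).choose i : R) *
            φ (MZV.binaryWord [2 * n - r + i, r - i]) +
          (-1 : R) ^ (r + 1) * ∑ j ∈ range (2 * n - r), ((r - 1 + j).choose j : R) *
            φ (MZV.binaryWord [r + j, 2 * n - r - j]) := by
      intro r hr
      rw [mem_Ico] at hr
      rw [hSh r (2 * n - r) (by omega) (by omega)]
      ring
    rw [Finset.sum_congr rfl h, Finset.sum_add_distrib, hA2, hA1]
  -- `Σ_r (-1)^{r+1} P(r)` via stuffle: `= 2 (D 1 + O - E) - Z`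
  have hsign : ∑ r ∈ Ico 1 (2 * n), (-1 : R) ^ (r + 1) = 1 := by
    have h := euler_altSum_Ico_one (fun _ => (1 : R)) n (by omega)
    simpa using h
  have hAlt : ∑ r ∈ Ico 1 (2 * n), (-1 : R) ^ (r + 1) * D r = D 1 + (O - E) := by
    rw [euler_altSum_Ico_one D n (by omega), Finset.sum_sub_distrib]
  have hAlt' : ∑ r ∈ Ico 1 (2 * n), (-1 : R) ^ (r + 1) * D (2 * n - r) = D 1 + (O - E) := by
    have hrefl := euler_sum_Ico_one_reflect (fun r => (-1 : R) ^ (r + 1) * D r) (2 * n)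
    rw [← hAlt, ← hrefl]
    refine Finset.sum_congr rfl fun r hr => ?_
    rw [mem_Ico] at hr
    rw [neg_one_pow_eq_pow_mod_two (R := R) (n := r + 1),
      neg_one_pow_eq_pow_mod_two (R := R) (n := 2 * n - r + 1),
      show (r + 1) % 2 = (2 * n - r + 1) % 2 by omega]
  have hParSt : ∑ r ∈ Ico 1 (2 * n), (-1 : R) ^ (r + 1) *
      (φ (MZV.binaryWord [r]) * φ (MZV.binaryWord [2 * n - r])) =
      (D 1 + (O - E)) + (D 1 + (O - E)) - Z := by
    have h : ∀ r ∈ Ico 1 (2 * n), (-1 : R) ^ (r + 1) *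
        (φ (MZV.binaryWord [r]) * φ (MZV.binaryWord [2 * n - r])) =
        (-1 : R) ^ (r + 1) * D r + (-1 : R) ^ (r + 1) * D (2 * n - r) -
          (-1 : R) ^ (r + 1) * Z := by
      intro r hr
      rw [mem_Ico] at hr
      rw [hSt r (by omega) (by omega)]
      ring
    rw [Finset.sum_congr rfl h, Finset.sum_sub_distrib, Finset.sum_add_distrib, hAlt, hAlt',
      ← Finset.sum_mul, hsign, one_mul]
  have hPAR : 2 * (O - E) = Z := by linear_combination hParSh - hParSt
  -- the sum formula `E + O = -Z` (shuffle and regularised stuffle for `r = 1`)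
  have hSF : E + O = -Z := by
    have h := hSh 1 (2 * n - 1) le_rfl (by omega)
    rw [hX1, zero_mul, Finset.sum_range_one] at h
    have h' : ∑ j ∈ range (2 * n - 1), ((1 - 1 + j).choose j : R) *
        φ (MZV.binaryWord [1 + j, 2 * n - 1 - j]) = ∑ j ∈ range (2 * n - 1), D (1 + j) := by
      refine Finset.sum_congr rfl fun j _ => ?_
      simp only [hD, Nat.sub_self, zero_add, Nat.choose_self, Nat.cast_one, one_mul, Nat.sub_sub]
    rw [h', show 2 * n - 1 = (2 * n - 2) + 1 by omega, Finset.sum_range_succ'] at h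
    have h2 : ∑ j ∈ range (2 * n - 2), D (1 + (j + 1)) = E + O := by
      rw [hE, hO, ← Finset.sum_add_distrib, euler_sum_Ico_two_even_odd D n (by omega) |>.symm,
        Finset.sum_Ico_eq_sum_range]
      refine Finset.sum_congr rfl fun j _ => ?_
      congr 1
      ring
    rw [h2] at h
    simp only [Nat.choose_zero_right, Nat.cast_one, one_mul, add_zero, Nat.sub_zero,
      show 2 * n - 2 + 1 = 2 * n - 1 by omega] at h
    have hD' : D (2 * n - 1) = φ (MZV.binaryWord [2 * n - 1, 1]) := by
      simp only [hD, show 2 * n - (2 * n - 1) = 1 by omega]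
    linear_combination -hSt1 - h + hD'
  -- Euler: sum the stuffle relations over even `r = 2j`
  have hS : ∑ j ∈ Ico 1 n, φ (MZV.binaryWord [2 * j]) * φ (MZV.binaryWord [2 * (n - j)]) =
      E + E - ((n - 1 : ℕ) : R) * Z := by
    have h : ∀ j ∈ Ico 1 n, φ (MZV.binaryWord [2 * j]) * φ (MZV.binaryWord [2 * (n - j)]) =
        D (2 * j) + D (2 * (n - j)) - Z := by
      intro j hj
      rw [mem_Ico] at hj
      rw [show 2 * (n - j) = 2 * n - 2 * j by omega, hSt (2 * j) (by omega) (by omega)]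
    have hrefl := euler_sum_Ico_one_reflect (fun j => D (2 * j)) n
    rw [Finset.sum_congr rfl h, Finset.sum_sub_distrib, Finset.sum_add_distrib, hrefl,
      Finset.sum_const, Nat.card_Ico, nsmul_eq_mul]
  have hcast : ((n - 1 : ℕ) : R) = (n : R) - 1 := by
    rw [Nat.cast_sub (by omega), Nat.cast_one]
  rw [hcast] at hS
  linear_combination 2 * hS + 2 * hSF - hPAR

end Main

end Summit.KontsevichZagierPeriods.FurushoPentagon.KernelModuloPeriodConjecture
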